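import Literature.Barriers.ValiantsHypothesis.BIJL18Thm6Witness
import Literature.Barriers.ValiantsHypothesis.BIJL18PerComplexityModP
import Literature.Barriers.ValiantsHypothesis.BIJL18Thm24Holds
import Literature.Computability.AlgebraicComplexity.VP0FamilyGoodPrimes
import HarnessLib

/-!
# Bläser–Ikenmeyer–Jindal–Lysikov 2018, Thm. 6 — DISCHARGED: `BIJL2018_thm6_holds`
# (`VP⁰`-natural proofs against `{per = 0}` ⇒ `P^{#P} ⊆ ∃·BPP`)

Discharge file of the typed fact `Literature.Barriers.ValiantsHypothesis.BIJL2018_thm6`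
(`BIJL18PermanentZero.lean`; M. Bläser, C. Ikenmeyer, G. Jindal, V. Lysikov, *Generalized matrix
completion and algebraic natural proofs*, STOC 2018 = ECCC TR18-064, Thm. 6). Last file of the route
(`PermanentLaplaceChain` → `SchwartzZippelCoinBlocks` → `PointSegmentBricks` → `BIJL18Thm6Verifier` →
`BIJL18Thm6Semantics` → `BIJL18Thm6Witness` → here):

* `exists_witness` — COMPLETENESS of the certificate language: for a `0/1` matrix `A` there is a
  short witness `⟨bin p, encList [w_0, …, w_n]⟩` in `L′` for `⟨⟨A⟩, bin per A⟩`: the prime `p` avoids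
  the coefficients of the `VP⁰` natural proofs `D_k`, `k ≤ n`, and exceeds `2^{n²+2+Σ deg D_k}`
  (`IsVP0Family.exists_prime_forall_map_zmod_ne_zero`, counting — the tree's `IsVP0Family` admits no
  height bound, see the module docstring of `VP0FamilyGoodPrimes.lean`); the small circuits for
  `per_k mod p` come from Thm. 24 with `e = 0` (`exists_complexity_perPoly_zmod_le`,
  `BIJL18PerComplexityModP.lean`) and are turned into codes by `Thm6Verifier.exists_levelCode`;
  the identities hold by `PermanentChain.cornerPer_chain`; the witness length is p-bounded;
* `permanent01Graph_presentation`, `permanent01Graph_mem_polyExists_BPP_of_naturalProofs` —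
  `graph(per) ∈ ∃·BPP` (the `∃·coRP` protocol: `semLang_mem_BPP`, `mem_permanent01Graph_of_mem_semLang`);
* **`BIJL2018_thm6_of_thm24 : BIJL2018_thm24 → BIJL2018_thm6`** and
  **`BIJL2018_thm6_holds : BIJL2018_thm6`** (with `BIJL2018_thm24_holds`): `P^{#P} ⊆ P^{per} ⊆ ∃·BPP`
  (Valiant; Kabanets–Impagliazzo Lemma 3 in the witness class, `PRel_per01_subset_polyExists_BPP`).

DEVIATION from the printed proof (ECCC p.19), disclosed in the docstring of `BIJL2018_thm6_holds`: the
`∃BPP` machine does not RUN Kaltofen's factoring algorithm; it GUESSES the circuits for `per_k` over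
`𝔽_p` (they exist and are short by Thm. 24, whose existence content is a theorem of the tree) together
with the prime `p`, and verifies them by Kabanets–Impagliazzo's row-expansion chain evaluated modulo
`p` at a random point (Schwartz–Zippel), with AKS for the primality of `p` and a formal-degree guard;
the prime is chosen by counting rather than by the height bound of Lemma 25 (unavailable for the
tree's fan-in-`≤ 2` reading of `VP⁰`, which makes the typed Thm. 6 slightly STRONGER than print).
HONEST FRAMING: a published conditional barrier theorem with a Boolean conclusion, now a theorem of
the tree; `VP ≠ VNP` is NOT proved and nothing here bears on it.

## References

* M. Bläser, C. Ikenmeyer, G. Jindal, V. Lysikov, STOC 2018 = ECCC TR18-064, Thm. 6, Thm. 24, §6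
  [BlaserIkenmeyerJindalLysikov2018].
* V. Kabanets, R. Impagliazzo, STOC 2003, Lemma 3, Lemma 11, Cor. 12 [KabanetsImpagliazzo2003].
* E. Kaltofen, STOC 1986 / Randomness and Computation 1989 [Kaltofen1989].
* M. Agrawal, N. Kayal, N. Saxena, Ann. of Math. 160 (2004) [AgrawalKayalSaxena2004].
* L. G. Valiant, TCS 8 (1979), Thm. 1 [Valiant1979].
-/

noncomputable section

namespace Literature.Barriers.ValiantsHypothesis

namespace Thm6Verifier

open Literature.Computability.Complexity Literature.Computability.AlgebraicComplexity
open Literature.Computability.QuantumComplexity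
open _root_.Computability Brick ModularZeroTest PointSeg CircuitCode PermanentChain MvPolynomial ArithCircuit

/-! ### Bookkeeping -/

/-- Partial sums of a p-bounded function are p-bounded. [cite: Burgisser2000, Def. 2.1(1)] -/
theorem isPBounded_sum_range {t : ℕ → ℕ} (ht : IsPBounded t) :
    IsPBounded fun n => ∑ k ∈ Finset.range (n + 1), t k := by
  obtain ⟨a, b, h⟩ := (IsPBounded.iff_exists_le_mul_succ_pow t).1 ht
  refine (IsPBounded.iff_exists_le_mul_succ_pow _).2 ⟨a, b + 1, fun n => ?_⟩
  calc ∑ k ∈ Finset.range (n + 1), t k ≤ ∑ k ∈ Finset.range (n + 1), a * (n + 1) ^ b :=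
        Finset.sum_le_sum fun k hk => (h k).trans (Nat.mul_le_mul_left a
          (Nat.pow_le_pow_left (by have := Finset.mem_range.1 hk; omega) b))
    _ = a * (n + 1) ^ (b + 1) := by rw [Finset.sum_const, Finset.card_range, smul_eq_mul]; ring

/-- A term of a partial sum is at most the sum. [folklore] -/
private theorem le_sum_range {t : ℕ → ℕ} {k n : ℕ} (hk : k ≤ n) : t k ≤ ∑ j ∈ Finset.range (n + 1), t j :=
  Finset.single_le_sum (fun j _ => Nat.zero_le (t j)) (Finset.mem_range.2 (Nat.lt_succ_of_le hk))

/-- The length of a nested-pair list code. [folklore] -/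
private theorem length_encList_le {l : List (List Bool)} {L : ℕ} (h : ∀ a ∈ l, a.length ≤ L) :
    (encList l).length ≤ l.length * (2 * L + 2) := by
  induction l with
  | nil => simp
  | cons a l ih =>
    rw [encList_cons, length_boolPair, List.length_cons, add_mul, one_mul]
    have h1 := h a (by simp)
    have h2 := ih fun b hb => h b (by simp [hb])
    omega

/-- Item `i` of a nested-pair list code. [folklore] -/
private theorem fstF_iterate_sndF_encList' (L : List (List Bool)) (i : ℕ) :
    fstF (sndF^[i] (encList L)) = L.getD i [] := by
  rw [← KIReduction.getD_readList, KIReduction.readList_encList]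

/-- **Assembling `Good` at given values of the dimension and the modulus** (avoids rewriting under
the dependent types `Fin (nOf x)`, `ZMod ⟦pb⟧`). [folklore] -/
private theorem good_intro {z pb W : List Bool} {n p : ℕ} (hn : KIReduction.nOf (boolPair z (boolPair pb W)) = n)
    (hp : bitsToNat pb = p)
    (h1 : fstF (boolPair z (boolPair pb W)) = KIReduction.canonX (boolPair z (boolPair pb W))) (h2 : p.Prime)
    (h3 : KIReduction.vOf (boolPair z (boolPair pb W)) < p) (h4 : 2 ^ bOf n ≤ p)
    (h5 : (rdCircuit (fstF W).length (fstF W)).formalDegree ≤ 1)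
    (h6 : ∀ i < n, (rdCircuit (fstF (sndF^[i + 1] W)).length (fstF (sndF^[i + 1] W))).formalDegree ≤ i + 1)
    (h7 : wordPoly p n (fstF W) = 1)
    (h8 : ∀ i < n, wordPoly p n (fstF (sndF^[i + 1] W)) = levelRHS (ZMod p) n i (wordPoly p n (fstF (sndF^[i] W))))
    (h9 : MvPolynomial.eval (fun ac : Fin n × Fin n =>
        ((KIReduction.parsedEntry (KIReduction.rowsStr (boolPair z (boolPair pb W))) ac.1.val ac.2.val : ℤ) : ZMod p))
      (wordPoly p n (fstF (sndF^[n] W))) = (KIReduction.vOf (boolPair z (boolPair pb W)) : ZMod p)) :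
    Good z pb W := by
  subst hn; subst hp
  exact ⟨h1, h2, h3, h4, h5, h6, h7, h8, h9⟩

/-! ### Completeness: the honest witness -/

/-- **The honest witness.** Under `VP⁰`-natural proofs against `{per = 0}` and Thm. 24 there is a
p-bounded `wl` such that every `0/1` matrix `A` (`m × m`) has a witness `u = ⟨bin p, W⟩` of length
`≤ wl m` with `⟨⟨⟨A⟩, bin per A⟩, u⟩ ∈ L′`: `p` a prime with `2^{m²+2+Σ_{k≤m} deg D_k} < p < 2^{q(m)}`
missing the coefficients of `D_0, …, D_m`, `W` the codes of `exists_levelCode` for the bounds of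
`exists_complexity_perPoly_zmod_le`. [cite: BlaserIkenmeyerJindalLysikov2018, Thm. 6 (proof, §6 p.19)]
[cite: KabanetsImpagliazzo2003, Lemma 11 and proof of Cor. 12 (p. 358)] -/
theorem exists_witness (h6 : HasVP0NaturalProofsAgainstPerZero) (h24 : BIJL2018_thm24) :
    ∃ wl : ℕ → ℕ, IsPBounded wl ∧ ∀ (m : ℕ) (M : Fin m → Fin m → ℤ), (∀ a c, M a c = 0 ∨ M a c = 1) →
      ∃ pb W : List Bool,
        Good (boolPair (encodingIntMatrix.encode ⟨m, M⟩) (encodeNat ((Matrix.of M).permanent).toNat)) pb W ∧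
          (boolPair pb W).length ≤ wl m := by
  obtain ⟨D, κ, hVP, hD0, hκ⟩ := exists_complexity_perPoly_zmod_le h6 h24
  -- p-bounded data of the natural proofs
  set T : ℕ → ℕ := fun n => ∑ k ∈ Finset.range (n + 1), (D k).totalDegree with hT
  set Cf : ℕ → ℕ := fun n => ∑ k ∈ Finset.range (n + 1), constantFreeComplexity (D k) with hCf
  have hTb : IsPBounded T := isPBounded_sum_range hVP.isPFamily.2
  have hCfb : IsPBounded Cf := isPBounded_sum_range hVP.isPBounded_constantFreeComplexity
  have hbOf : IsPBounded bOf :=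
    IsPBounded.add_holds (IsPBounded.pow_holds IsPBounded.id 2) (IsPBounded.const 2)
  -- the good prime
  obtain ⟨q, hq, hprime⟩ := hVP.exists_prime_forall_map_zmod_ne_zero hD0 (M := fun n => 2 ^ (bOf n + T n))
    ((IsPBounded.add_holds hbOf hTb).mono fun n => le_of_eq (Nat.log_pow Nat.one_lt_two _))
  -- the size bounds
  set S : ℕ → ℕ := fun m => (m * m + Cf m + T m + q m + 2) ^ κ with hS
  set Z : ℕ → ℕ := fun m => m ^ 2 * S m + m + m * m with hZ
  set Lw : ℕ → ℕ := fun m => 26 * (3 * Z m + 1) * (q m + Z m + m * m + 6) with hLw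
  refine ⟨fun m => 2 * q m + 2 + (m + 1) * (2 * Lw m + 2), ?_, fun m M hM => ?_⟩
  · -- p-boundedness of the witness length
    have hmm : IsPBounded fun m => m * m := IsPBounded.mul_holds IsPBounded.id IsPBounded.id
    have hSb : IsPBounded S := IsPBounded.pow_holds (IsPBounded.add_holds (IsPBounded.add_holds
      (IsPBounded.add_holds (IsPBounded.add_holds hmm hCfb) hTb) hq) (IsPBounded.const 2)) κ
    have hZb : IsPBounded Z := IsPBounded.add_holds (IsPBounded.add_holds
      (IsPBounded.mul_holds (IsPBounded.pow_holds IsPBounded.id 2) hSb) IsPBounded.id) hmm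
    have hLwb : IsPBounded Lw := IsPBounded.mul_holds (IsPBounded.mul_holds (IsPBounded.const 26)
      (IsPBounded.add_holds (IsPBounded.mul_holds (IsPBounded.const 3) hZb) (IsPBounded.const 1)))
      (IsPBounded.add_holds (IsPBounded.add_holds (IsPBounded.add_holds hq hZb) hmm) (IsPBounded.const 6))
    exact IsPBounded.add_holds (IsPBounded.add_holds (IsPBounded.mul_holds (IsPBounded.const 2) hq) (IsPBounded.const 2))
      (IsPBounded.mul_holds (IsPBounded.add_holds IsPBounded.id (IsPBounded.const 1))
        (IsPBounded.add_holds (IsPBounded.mul_holds (IsPBounded.const 2) hLwb) (IsPBounded.const 2)))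
  · -- the witness for `A = M`
    obtain ⟨p, hp, hMp, hpq, hgood⟩ := hprime m
    haveI : Fact p.Prime := ⟨hp⟩
    have hp2 : 2 ≤ p := hp.two_le
    have h2b : 2 ^ bOf m ≤ p := le_of_lt (lt_of_le_of_lt (Nat.pow_le_pow_right (by norm_num) (by omega)) hMp)
    have hlogp : Nat.log 2 p ≤ q m := (Nat.log_lt_iff_lt_pow Nat.one_lt_two hp.ne_zero).2 hpq |>.le
    -- complexity of `per_k mod p`, `k ≤ m`
    have hcomp : ∀ k, k ≤ m → complexity (perPoly (Fin k) (ZMod p)) ≤ S m := by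
      intro k hk
      rcases Nat.eq_zero_or_pos k with rfl | hk0
      · rw [complexity_perPoly_zero]; exact Nat.zero_le _
      · obtain ⟨k', rfl⟩ : ∃ k', k = k' + 1 := ⟨k - 1, by omega⟩
        have hdegp : (D (k' + 1)).totalDegree < p := by
          have h1 : (D (k' + 1)).totalDegree ≤ T m := le_sum_range (t := fun k => (D k).totalDegree) hk
          have h2 : T m < 2 ^ T m := Nat.lt_two_pow_self
          have h3 : 2 ^ T m ≤ 2 ^ (bOf m + T m) := Nat.pow_le_pow_right (by norm_num) (by omega)
          omega
        refine (hκ p k' (hgood (k' + 1) hk) hdegp).trans (Nat.pow_le_pow_left ?_ κ)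
        have h1 : (k' + 1) * (k' + 1) ≤ m * m := Nat.mul_le_mul hk hk
        have h2 : constantFreeComplexity (D (k' + 1)) ≤ Cf m := le_sum_range (t := fun k => constantFreeComplexity (D k)) hk
        have h3 : (D (k' + 1)).totalDegree ≤ T m := le_sum_range (t := fun k => (D k).totalDegree) hk
        omega
    -- the codes
    have hcode : ∀ k, k ≤ m → ∃ w : List Bool, wordPoly p m w = cornerPer (ZMod p) m k ∧
        (rdCircuit w.length w).formalDegree ≤ max k 1 ∧ m * m ≤ w.length ∧ w.length ≤ Lw m := by
      intro k hk
      obtain ⟨w, hw1, hw2, hw3, hw4⟩ := exists_levelCode p hk (hcomp k hk)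
      refine ⟨w, hw1, hw2, hw3, hw4.trans ?_⟩
      have hk2 : k ^ 2 * S m + k + m * m ≤ Z m := by
        simp only [hZ]
        have : k ^ 2 ≤ m ^ 2 := Nat.pow_le_pow_left hk 2
        have := Nat.mul_le_mul_right (S m) this
        omega
      have hps : p.size ≤ q m := Nat.size_le.2 hpq
      have hms : (m * m).size ≤ m * m := Nat.size_le.2 Nat.lt_two_pow_self
      simp only [hLw]
      exact Nat.mul_le_mul (Nat.mul_le_mul_left _ (by omega)) (by omega)
    have hcode' : ∀ k, ∃ w : List Bool, k ≤ m → (wordPoly p m w = cornerPer (ZMod p) m k ∧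
        (rdCircuit w.length w).formalDegree ≤ max k 1 ∧ m * m ≤ w.length ∧ w.length ≤ Lw m) := by
      intro k
      by_cases hk : k ≤ m
      · obtain ⟨w, hw⟩ := hcode k hk
        exact ⟨w, fun _ => hw⟩
      · exact ⟨[], fun h => absurd h hk⟩
    choose wk hwk using hcode'
    set ws : List (List Bool) := (List.range (m + 1)).map wk with hws
    have hitem : ∀ i, i ≤ m → fstF (sndF^[i] (encList ws)) = wk i := by
      intro i hi
      rw [fstF_iterate_sndF_encList', hws, List.getD_eq_getElem?_getD, List.getElem?_map,
        List.getElem?_range (Nat.lt_succ_of_le hi)]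
      rfl
    -- the instance
    set v : ℕ := ((Matrix.of M).permanent).toNat with hv
    set z := boolPair (encodingIntMatrix.encode ⟨m, M⟩) (encodeNat v) with hz
    obtain ⟨hn, hvOf, hE⟩ := KIReduction.parse_canonical M hM v (boolPair (encodeNat p) (encList ws))
    have hper0 : 0 ≤ (Matrix.of M).permanent :=
      Matrix.permanent_nonneg_of_nonneg _ fun a c => by rcases hM a c with h | h <;> simp [h]
    have hvlt : v < p := by
      have h1 : (Matrix.of M).permanent ≤ m.factorial := by
        have := Matrix.permanent_le_factorial (Matrix.of M) (fun a c => by rcases hM a c with h | h <;> simp [h])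
          (fun a c => by rcases hM a c with h | h <;> simp [h])
        simpa using this
      have h2 : v ≤ m.factorial := by
        rw [hv]; exact (Int.toNat_le_toNat h1).trans (by simp)
      exact lt_of_le_of_lt h2 (lt_of_lt_of_le (factorial_lt_two_pow_bOf m) h2b)
    refine ⟨encodeNat p, encList ws, good_intro hn (bitsToNat_encodeNat p) ?_ hp (by rw [hvOf]; exact hvlt) h2b
      ?_ ?_ ?_ ?_ ?_, ?_⟩
    · rw [fstF_boolPair, hz, KIReduction.canonX_canonical M hM v]
    · have h := (hwk 0 (Nat.zero_le m)).2.1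
      rw [← hitem 0 (Nat.zero_le m)] at h
      simpa using h
    · intro i hi
      have h := (hwk (i + 1) hi).2.1
      rw [← hitem (i + 1) hi] at h
      exact h.trans (by omega)
    · have h := (hwk 0 (Nat.zero_le m)).1
      rw [← hitem 0 (Nat.zero_le m), cornerPer_zero] at h
      exact h
    · intro i hi
      rw [hitem (i + 1) hi, hitem i hi.le, (hwk (i + 1) hi).1, (hwk i hi.le).1]
      exact cornerPer_succ hi
    · rw [hitem m le_rfl, (hwk m le_rfl).1, cornerPer_self, PermanentChain.eval_perPoly, hvOf]
      have hmat : (Matrix.of fun a c : Fin m => ((fun ac : Fin m × Fin m =>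
          ((KIReduction.parsedEntry (KIReduction.rowsStr (boolPair z (boolPair (encodeNat p) (encList ws)))) ac.1.val ac.2.val : ℤ) :
            ZMod p)) (a, c))) = (Matrix.of M).map (Int.castRingHom (ZMod p)) := by
        ext a c
        simp only [Matrix.of_apply, Matrix.map_apply, eq_intCast]
        rw [hz, hE a.val c.val a.isLt c.isLt]
      rw [hmat, KIReduction.permanent_map', eq_intCast, hv, ← Int.cast_natCast, Int.toNat_of_nonneg hper0]
    · -- the length
      show _ ≤ 2 * q m + 2 + (m + 1) * (2 * Lw m + 2)
      rw [length_boolPair, TM2Pass.length_encodeNat_eq_size]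
      have hps : p.size ≤ q m := Nat.size_le.2 hpq
      have hW : (encList ws).length ≤ (m + 1) * (2 * Lw m + 2) := by
        refine (length_encList_le (L := Lw m) fun a ha => ?_).trans ?_
        · rw [hws, List.mem_map] at ha
          obtain ⟨k, hk, rfl⟩ := ha
          exact (hwk k (Nat.le_of_lt_succ (List.mem_range.1 hk))).2.2.2
        · rw [hws, List.length_map, List.length_range]
      omega

/-! ### The graph of the permanent in `∃·BPP` -/

/-- **The certificate presentation of `graph(per)`**: for a polynomial `Q`,
`z ∈ permanent01Graph ↔ ∃ u, |u| ≤ Q(|z|) ∧ ⟨z, u⟩ ∈ L′`. [cite: BlaserIkenmeyerJindalLysikov2018, Thm. 6 (proof, §6 p.19)]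
[cite: KabanetsImpagliazzo2003, Lemma 11 and proof of Cor. 12 (p. 358)] -/
theorem permanent01Graph_presentation (h6 : HasVP0NaturalProofsAgainstPerZero) (h24 : BIJL2018_thm24) :
    ∃ Q : Polynomial ℕ, ∀ z : List Bool,
      z ∈ permanent01Graph ↔ ∃ u : List Bool, u.length ≤ Q.eval z.length ∧ boolPair z u ∈ semLang := by
  obtain ⟨wl, hwl, hwit⟩ := exists_witness h6 h24
  obtain ⟨a, b, hab⟩ := (IsPBounded.iff_exists_le_mul_succ_pow wl).1 hwl
  refine ⟨Polynomial.C a * (Polynomial.X + 1) ^ b, fun z => ⟨fun hz => ?_, fun ⟨u, _, hu⟩ => mem_permanent01Graph_of_mem_semLang hu⟩⟩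
  obtain ⟨m, M, hM, rfl⟩ := hz
  obtain ⟨pb, W, hg, hlen⟩ := hwit m M hM
  refine ⟨boolPair pb W, hlen.trans ((hab m).trans ?_), _, pb, W, rfl, hg⟩
  have hm : m ≤ (boolPair (encodingIntMatrix.encode ⟨m, M⟩) (encodeNat ((Matrix.of M).permanent).toNat)).length := by
    have := BosonCodes.le_codeLen M
    rw [BosonCodes.codeLen] at this
    rw [length_boolPair]; omega
  simp only [Polynomial.eval_mul, Polynomial.eval_C, Polynomial.eval_pow, Polynomial.eval_add, Polynomial.eval_X,
    Polynomial.eval_one]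
  exact Nat.mul_le_mul_left a (Nat.pow_le_pow_left (by omega) b)

/-- **`graph(per) ∈ ∃·BPP` under `VP⁰`-natural proofs against `{per = 0}` and Thm. 24.**
[cite: BlaserIkenmeyerJindalLysikov2018, Thm. 6 (proof, §6 p.19)] -/
theorem permanent01Graph_mem_polyExists_BPP_of_naturalProofs (h6 : HasVP0NaturalProofsAgainstPerZero)
    (h24 : BIJL2018_thm24) : permanent01Graph ∈ polyExists BPP := by
  obtain ⟨Q, hQ⟩ := permanent01Graph_presentation h6 h24
  exact ⟨semLang, semLang_mem_BPP, Q, hQ⟩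

end Thm6Verifier

open Literature.Computability.Complexity Literature.Computability.AlgebraicComplexity
open Literature.Computability.QuantumComplexity _root_.Computability

/-! ### The discharge -/

/-- **BIJL Thm. 6 from Thm. 24**: `VP⁰`-natural proofs against the matrices of permanent zero put
`P^{#P} ⊆ P^{per} ⊆ ∃·BPP` (Valiant's theorem; the graph of the permanent in `∃·BPP` by the guessed-prime
protocol `Thm6Verifier.*`; Kabanets–Impagliazzo's Lemma 3 in the witness class,
`PRel_per01_subset_polyExists_BPP`). [cite: BlaserIkenmeyerJindalLysikov2018, Thm. 6] -/
theorem BIJL2018_thm6_of_thm24 (h24 : BIJL2018_thm24) : BIJL2018_thm6 := fun h6 =>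
  (PSharpP_subset_PRel_per01Fn permanent01_isSharpPHardFun_holds).trans
    (PRel_per01_subset_polyExists_BPP (Thm6Verifier.permanent01Graph_mem_polyExists_BPP_of_naturalProofs h6 h24))

/-- **Bläser–Ikenmeyer–Jindal–Lysikov 2018, Thm. 6, DISCHARGED**: "If there are `VP⁰`-natural proofs
over characteristic zero against the set of matrices with permanent zero, then `P^{#P} ⊆ ∃BPP`."
Proof in the tree: the natural proofs `D_k` are nonzero `VP⁰` multiples of `per_k`
(`hasVP0NaturalProofsAgainstPerZero_iff_perPoly_dvd`); modulo a prime `p` missing one coefficient of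
each `D_k`, `k ≤ n` (counting, `IsVP0Family.exists_prime_forall_map_zmod_ne_zero`), Kaltofen's theorem
over `𝔽_p` (Thm. 24 with `e = 0`, `BIJL2018_thm24_holds`, `exists_complexity_perPoly_zmod_le`) gives
small circuits for `per_k` with constants in `𝔽_p`, hence polynomial-length integer codes
(`exists_levelCode`: homogenisation with formal degree, ballast, lifting); an `∃·coRP` machine guesses
`p` and the codes and verifies them (`Thm6Verifier.verifF`: canonical instance, AKS primality,
`v < p`, `2^{n²+2} ≤ p`, formal-degree guards, Kabanets–Impagliazzo's row-expansion chain and the final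
evaluation checked modulo `p` at one random matrix — Schwartz–Zippel over `𝔽_p`,
`semLang_mem_coRP`), so `graph(per) ∈ ∃·BPP`, `P^{per} ⊆ ∃·BPP` (KI Lemma 3) and `P^{#P} ⊆ P^{per}`
(Valiant). DEVIATION from the printed proof (ECCC p.19), disclosed: the machine GUESSES the factor
circuits (whose existence and size is Thm. 24) instead of running Kaltofen's algorithm, verifies them by
the Kabanets–Impagliazzo chain rather than on `Z_k(X)`, and picks `p` by counting rather than by the
height bound of Lemma 25 (the tree's `VP⁰` allows fan-in `≤ 2` with empty gates, for which no height
bound holds — so the typed hypothesis is weaker and the typed theorem slightly stronger than print).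
HONEST FRAMING: a 2018 conditional barrier theorem with a Boolean conclusion, now a theorem of the
tree; `VP ≠ VNP` is NOT proved and nothing here bears on it.
[cite: BlaserIkenmeyerJindalLysikov2018, Thm. 6] locator: ECCC TR18-064 p.7 (statement), p.19 (proof) -/
theorem BIJL2018_thm6_holds : BIJL2018_thm6 :=
  BIJL2018_thm6_of_thm24 BIJL2018_thm24_holds

/-- **Thm. 6 over complex points, DISCHARGED** (§7's phrasing): `VP⁰`-natural proofs vanishing on the
complex hypersurface `{per = 0}` put `P^{#P}` in `∃·BPP`. [cite: BlaserIkenmeyerJindalLysikov2018, Thm. 6 and §7] -/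
theorem BIJL2018_thm6_complex_holds
    (hc : ∃ D : ∀ n : ℕ, MvPolynomial (Fin n × Fin n) ℤ, IsVP0Family D ∧
      ∀ n, D n ≠ 0 ∧ ∀ A : Matrix (Fin n) (Fin n) ℂ, A.permanent = 0 →
        MvPolynomial.aeval (fun ij : Fin n × Fin n => A ij.1 ij.2) (D n) = 0) :
    PSharpP ⊆ polyExists BPP :=
  BIJL2018_thm6_holds.complex hc

end Literature.Barriers.ValiantsHypothesis

end
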